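import Summits.QuantumFields.YangMills.Theorems.BalabanUVNodesN15KingModelAnalyticWindow
import Summits.QuantumFields.YangMills.Theorems.BalabanUVNodesN15KingModelComplexLinkSharpWindow
import HarnessLib

/-!
# BalabanUVNodes ∕ N15 — THE KING-MODEL RUNG (PART Ϩ-j): BAŁABAN's SCALE IS SHARP IN ORDER — in King's scaling `c = L²` the admissible radius of print's slice around `U₀ ≡ 1` is PINCHED
# between `s₀(m²,0,d)∕L` (PART Ϩ-g: everything works, fine layer `a = 0`, `κ = m²`) and `3√m²∕L` (PART Ϛ-d's dilation `U ≡ a♯·1` makes `A(U,U⁻¹)` SINGULAR): the holomorphy radius in the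
# link field is `Θ(η)` for fixed `(m²,d)` — neither `O(η²)` (the two-sided artefact) nor `o(η)`-improvable
# (Track A, DAG node N15 = NE2; FAN-OUT v1.1 §N15 s3 «KING-MODEL RUNG … + what the curved case adds»; count-neutral)

HONEST FRAMING.  Count-neutral (cell `pub-ymgap`, seat `pub-ymgap-dag-n15-e` g51; `--supports stmt-QuantumFields-27247 --as helper` = K3ᴬ, KEY MAP v3).  The singular witness is for the
FINE layer (`a = 0`: PART Ϛ-d `not_isUnit_cxLapF_inv_slice_edge`, the constants are killed); with the block term (`a > 0`) the constants are no longer in the kernel and the singular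
dilation moves — not computed here.  The positive side is PART Ϩ-g at `a = 0`, `κ = m²`.  NOT Bałaban's multi-level `G_k(U)`; NOT a node discharge; nothing continuum ∕ ℝ⁴ ∕ OS ∕ Clay.

THE RESULTS (`c = L²`, `m² > 0`, any tree contour system of depth `≤ (d+1)(L−1)`, any volume, any fibre; `ε⋆ = m²∕(2(d+1)L²)`, `a♯ = 1 + ε⋆ + √(ε⋆(2+ε⋆))`):
* §1 `re_quadForm_fullOpU_one_ge_mass` (`m²Σ‖v_x‖² ≤ Re⟨v, A₀(1)v⟩` at `a = 0`: the free field is `m²`-coercive), `edgeDil_sub_one_le` (`2(d+1)L² ≥ m²` ⟹ `a♯ − 1 ≤ 3√m²∕L`), `norm_dilation_sub_one_le`.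
* §2 ★★★ **`not_isUnit_cxFullOp_slice_dilation`** (`a = 0`: `A(a♯·1, (a♯·1)⁻¹)` is NOT invertible), ★★★★ **`slice_radius_sharp_order`** (`∃ U` with `‖U_b − 1‖ ≤ 3√m²∕L` on every bond and
  `A(U,U⁻¹)` singular — while, ★★★ **`slice_radius_works_free`**, every `U` with `‖U_b − 1‖ ≤ s₀(m²,0,d)∕L` gives an invertible `A(U,U⁻¹)` with `‖G‖ ≤ 4∕m²` and decay: THE RADIUS IS `Θ(η)`).
PRIOR TREE ART (by name): Ϛ-d (`edgeEps`, `edgeDil`, `edgeDil_gt`, `edgeDil_pos`, `edgeDil_add_inv`, `window_mul_edgeEps`, `not_isUnit_cxLapF_inv_slice_edge`, `smul_one_inv`), Ϩ-g (`sliceRadius`, `king_B9_thm34_shape`),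
Ϩ-a (`cxFullOp_zero_blockCoupling`), Ϥ-d (`re_quadForm_fullOpU`), Mathlib.  Dedup (rg at filing): basename 0 files; needles `slice_radius_sharp|not_isUnit_cxFullOp_slice_dilation|edgeDil_sub_one_le` 0 tree files.
presearch: n/a.  Locators: [Balaban1985BackgroundPropagators] Thm 3.4 p.400 (l.4 «α₁ sufficiently small»), §3.B p.399 l.37–40; [King1986] (4.4) p.670.  0 `sorry`, 0 `def`.
-/

noncomputable section
open scoped BigOperators ComplexConjugate ComplexOrder Matrix.Norms.L2Operator
open Finset Matrix

namespace Summit.QuantumFields.YangMills.BalabanUVNodes.N15KingModelRung.Analytic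

open Literature.MathematicalPhysics.QuantumFieldTheory.LatticeDiamagneticInequality (blk)
open Literature.MathematicalPhysics.QuantumFieldTheory.Balaban1983to89.B5Prop11Plancherel (Tor fine unitVec)
open Literature.MathematicalPhysics.QuantumFieldTheory.King1986.Torus (tdistT)
open Summit.QuantumFields.YangMills.BalabanUVNodes.N15KingModelRung.Covariant
  (fib edgeEps edgeDil edgeDil_gt edgeDil_pos edgeDil_add_inv window_mul_edgeEps not_isUnit_cxLapF_inv_slice_edge smul_one_inv)
open Summit.QuantumFields.YangMills.BalabanUVNodes.N15KingModelRung.CovariantBlock (BlockTree covQ fullOpU re_quadForm_fullOpU)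
open Summit.QuantumFields.YangMills.BalabanUVNodes.N15KingModelRung.CombesThomas (ctRate)

variable {d : ℕ} {L : ℕ} [NeZero L] (T : BlockTree d L) (M : Fin (d + 1) → ℕ) [hM : ∀ μ, NeZero (M μ)]
variable {𝕜 : Type*} [RCLike 𝕜] {n : Type*} [Fintype n] [DecidableEq n]

/-! ## §1 The free field is `m²`-coercive; the size of the singular dilation -/

/-- AT `a = 0` THE FREE FIELD `U₀ ≡ 1` IS `m²`-COERCIVE (any `c ≥ 0`): `m²Σ‖v_x‖² ≤ Re⟨v, A₀(1)v⟩`. [cite: King1986, (4.4) p.670] -/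
theorem re_quadForm_fullOpU_one_ge_mass {c : ℝ} (hc : 0 ≤ c) (m2 : ℝ) (v : Tor (fine L M) × n → 𝕜) :
    m2 * ∑ x, ‖fib (fine L M) v x‖ ^ 2 ≤ RCLike.re (star v ⬝ᵥ (fullOpU T M 0 c m2 (fun _ => (1 : Matrix n n 𝕜)) *ᵥ v)) := by
  rw [re_quadForm_fullOpU T M 0 c m2 (fun _ => Submonoid.one_mem _) v, zero_mul, zero_mul, add_zero]
  have hE : 0 ≤ c * ∑ x, ∑ μ, Curvature.bondE (fine L M) (fun _ => (1 : Matrix n n 𝕜)) v x μ :=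
    mul_nonneg hc (Finset.sum_nonneg fun _ _ => Finset.sum_nonneg fun _ _ => by rw [Curvature.bondE]; exact sq_nonneg _)
  linarith

omit [NeZero L] in
/-- THE SINGULAR DILATION IS `O(η)`-CLOSE TO `1`: with `c = L²`, `m² > 0` and `m² ≤ 2(d+1)L²` (so `ε⋆ ≤ 1`), `a♯ − 1 = ε⋆ + √(ε⋆(2+ε⋆)) ≤ 3√ε⋆ ≤ 3√m²∕L`.
[cite: Balaban1985BackgroundPropagators, Thm 3.4 p.400] -/
theorem edgeDil_sub_one_le (hL : 1 ≤ L) {m2 : ℝ} (hm : 0 < m2) (hmL : m2 ≤ 2 * ((d : ℝ) + 1) * (L : ℝ) ^ 2) :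
    edgeDil d ((L : ℝ) ^ 2) m2 - 1 ≤ 3 * Real.sqrt m2 / L := by
  have hL0 : (0 : ℝ) < L := by exact_mod_cast hL
  have hd : (0 : ℝ) < 2 * ((d : ℝ) + 1) := by positivity
  set e := edgeEps d ((L : ℝ) ^ 2) m2 with hedef
  have he : e = m2 / (2 * ((d : ℝ) + 1) * (L : ℝ) ^ 2) := rfl
  have he0 : 0 ≤ e := by rw [he]; positivity
  have he1 : e ≤ 1 := by rw [he, div_le_one (by positivity)]; exact hmL
  have hsq : Real.sqrt (e * (2 + e)) ≤ 2 * Real.sqrt e := by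
    rw [show 2 * Real.sqrt e = Real.sqrt (4 * e) by rw [Real.sqrt_mul (by norm_num), show Real.sqrt 4 = 2 by rw [show (4:ℝ) = 2^2 by norm_num, Real.sqrt_sq (by norm_num)]]]
    exact Real.sqrt_le_sqrt (by nlinarith)
  have hee : e ≤ Real.sqrt e := by
    have h := Real.sqrt_le_sqrt he1
    rw [Real.sqrt_one] at h
    calc e = Real.sqrt e * Real.sqrt e := (Real.mul_self_sqrt he0).symm
      _ ≤ Real.sqrt e * 1 := mul_le_mul_of_nonneg_left h (Real.sqrt_nonneg _)
      _ = Real.sqrt e := mul_one _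
  -- `√e ≤ √m² ∕ L` since `e = m²∕(2(d+1)L²) ≤ m²∕L²`
  have hsqe : Real.sqrt e ≤ Real.sqrt m2 / L := by
    rw [le_div_iff₀ hL0]
    have h1 : Real.sqrt e * L = Real.sqrt (e * (L : ℝ) ^ 2) := by rw [Real.sqrt_mul he0, Real.sqrt_sq hL0.le]
    rw [h1]
    refine Real.sqrt_le_sqrt ?_
    have h2 : e * (L : ℝ) ^ 2 = m2 / (2 * ((d : ℝ) + 1)) := by rw [he]; field_simp
    rw [h2]
    exact div_le_self hm.le (by linarith)
  unfold edgeDil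
  rw [← hedef, mul_div_assoc]
  linarith

/-- The dilated field sits within `a♯ − 1` of the free field on every bond (`‖(a♯ − 1)·1‖ ≤ a♯ − 1`). [folklore] -/
theorem norm_dilation_sub_one_le {r : ℝ} (hr : 1 ≤ r) : ‖(((r : ℝ) : 𝕜)) • (1 : Matrix n n 𝕜) - 1‖ ≤ r - 1 := by
  have h : (((r : ℝ) : 𝕜)) • (1 : Matrix n n 𝕜) - 1 = ((((r - 1 : ℝ)) : 𝕜)) • (1 : Matrix n n 𝕜) := by
    rw [RCLike.ofReal_sub, RCLike.ofReal_one, sub_smul, one_smul]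
  rw [h, norm_smul, RCLike.norm_ofReal, abs_of_nonneg (by linarith)]
  calc (r - 1) * ‖(1 : Matrix n n 𝕜)‖ ≤ (r - 1) * 1 := by
        refine mul_le_mul_of_nonneg_left ?_ (by linarith)
        rw [Matrix.cstar_norm_def, map_one]; exact ContinuousLinearMap.norm_id_le
    _ = r - 1 := mul_one _

/-! ## §2 The radius is `Θ(η)` -/

/-- ★★★ **THE DILATION MAKES PRINT's CONTINUED OPERATOR SINGULAR** (fine layer `a = 0`, `c = L² > 0`, `m² > 0`, nonempty fibre): `A(a♯·1, (a♯·1)⁻¹)` is NOT invertible.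
[cite: Balaban1985BackgroundPropagators, §3.B p.399 l.37–40, Thm 3.4 p.400] -/
theorem not_isUnit_cxFullOp_slice_dilation [Nonempty n] (hL : 1 ≤ L) {m2 : ℝ} (hm : 0 < m2) :
    ¬ IsUnit (cxFullOp T M 0 ((L : ℝ) ^ 2) m2 (fun _ : Tor (fine L M) × Fin (d + 1) => (((edgeDil d ((L : ℝ) ^ 2) m2 : ℝ) : 𝕜)) • (1 : Matrix n n 𝕜))
      (fun bd => ((fun _ : Tor (fine L M) × Fin (d + 1) => (((edgeDil d ((L : ℝ) ^ 2) m2 : ℝ) : 𝕜)) • (1 : Matrix n n 𝕜)) bd)⁻¹)) := by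
  have hL0 : (0 : ℝ) < L := by exact_mod_cast hL
  have hc : (0 : ℝ) < (L : ℝ) ^ 2 := by positivity
  rw [cxFullOp_zero_blockCoupling]
  simp only [smul_one_inv (edgeDil_pos hc.le hm.le).ne']
  exact not_isUnit_cxLapF_inv_slice_edge (fine L M) hc hm

/-- ★★★★ **BAŁABAN's SCALE IS SHARP IN ORDER — THE FAILING SIDE**: `c = L²`, `a = 0`, `m² > 0`, `m² ≤ 2(d+1)L²`, nonempty fibre: there is a complex link field `U` with `‖U_b − 1‖ ≤ 3√m²∕L` on EVERY
bond such that `A(U,U⁻¹)` is NOT invertible — no holomorphy radius `s∕L` with `s > 3√m²` is possible around `U₀ ≡ 1`. [cite: Balaban1985BackgroundPropagators, Thm 3.4 p.400, §3.B p.399 l.37–40] -/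
theorem slice_radius_sharp_order [Nonempty n] (hL : 1 ≤ L) {m2 : ℝ} (hm : 0 < m2) (hmL : m2 ≤ 2 * ((d : ℝ) + 1) * (L : ℝ) ^ 2) :
    ∃ U : Tor (fine L M) × Fin (d + 1) → Matrix n n 𝕜, (∀ bd, ‖U bd - 1‖ ≤ 3 * Real.sqrt m2 / L) ∧ ¬ IsUnit (cxFullOp T M 0 ((L : ℝ) ^ 2) m2 U (fun bd => (U bd)⁻¹)) := by
  have hL0 : (0 : ℝ) < L := by exact_mod_cast hL
  refine ⟨fun _ => (((edgeDil d ((L : ℝ) ^ 2) m2 : ℝ) : 𝕜)) • (1 : Matrix n n 𝕜), fun bd => ?_, not_isUnit_cxFullOp_slice_dilation T M hL hm⟩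
  have hgt := edgeDil_gt (d := d) (by positivity : (0 : ℝ) < (L : ℝ) ^ 2) hm
  have hε0 : 0 ≤ edgeEps d ((L : ℝ) ^ 2) m2 := by unfold edgeEps; positivity
  exact (norm_dilation_sub_one_le (by linarith)).trans (edgeDil_sub_one_le hL hm hmL)

/-- ★★★ **THE WORKING SIDE AT THE SAME ORDER** (`a = 0`, `c = L²`, `m² > 0`, any contour system of depth `≤ (d+1)(L−1)`, any volume, any fibre): every complex `U` with `‖U_b − 1‖ ≤ ε`, `Lε ≤ s₀(m²,0,d)`
gives an invertible `A(U,U⁻¹)` with `‖G(U,U⁻¹)‖ ≤ 4∕m²` and `‖blk G(U,U⁻¹) x y‖ ≤ (8∕m²)e^{−ctRate(m²∕2,0,d)d(x,y)∕L}` — so the admissible radius is pinched between `s₀(m²,0,d)∕L` and `3√m²∕L`: `Θ(η)`.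
[cite: Balaban1985BackgroundPropagators, Thm 3.4 p.400; King1986, (4.4) p.670] -/
theorem slice_radius_works_free (hD : ∀ j, T.depth j ≤ (d + 1) * (L - 1)) (hL : 1 ≤ L) {m2 : ℝ} (hm : 0 < m2)
    {U : Tor (fine L M) × Fin (d + 1) → Matrix n n 𝕜} {ε : ℝ} (hε0 : 0 ≤ ε) (hU : ∀ bd, ‖U bd - 1‖ ≤ ε) (hrad : (L : ℝ) * ε ≤ sliceRadius m2 0 d) :
    IsUnit (cxFullOp T M 0 ((L : ℝ) ^ 2) m2 U (fun bd => (U bd)⁻¹))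
    ∧ ‖(cxFullOp T M 0 ((L : ℝ) ^ 2) m2 U (fun bd => (U bd)⁻¹))⁻¹‖ ≤ 4 / m2
    ∧ ∀ x y : Tor (fine L M), ‖blk (cxFullOp T M 0 ((L : ℝ) ^ 2) m2 U (fun bd => (U bd)⁻¹))⁻¹ x y‖ ≤ 8 / m2 * Real.exp (-(ctRate (m2 / 2) 0 d / L * tdistT (fine L M) x y)) :=
  king_B9_thm34_shape T M hD le_rfl hm.le hL (U₀ := fun _ => (1 : Matrix n n 𝕜)) (fun _ => Submonoid.one_mem _) hm
    (re_quadForm_fullOpU_one_ge_mass T M (by positivity) m2) hε0 hU hrad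

end Summit.QuantumFields.YangMills.BalabanUVNodes.N15KingModelRung.Analytic

end
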